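import Summits.QuantumFields.YangMills.Theorems.UnitScaleTiltProp7ComplementaryProjectorPointwiseDecayClosed
import HarnessLib

/-!
# Route `UnitScaleTilt`, crux K1 «MinimiserStabilityRegPr» (stmt-QuantumFields-19200), EX face after S45, rows `hPcol` ∕ `h349` — **P2: THE ROW SUM OF THE POINTWISE KERNEL OF
# `P = 1 − R_{Q″}(U₀)` — `P` AND `R = projR` ARE BOUNDED `ℓ^∞ → ℓ^∞` ON THE FINE SITES, K-FREE AT THE PIN** (V5b ✓p762991's kernel `(c₀∕c₁)·C·e^{−μ′·tdist(B x, B x′)}` summed over the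
# source site `x′`: the block volume `(L^d)^{K−n}` it produces is EXACTLY cancelled by V5b's `c₀∕c₁ = η³` at the pin `c₁ = c₀ℓ³`; px5 g12 LOCATE-hPcol 9923ee3f §3, file P2)

Cell `ym3-torus` (HUMAN RULING D-0037; rung R3 = SU(2) YM₃ on T³ — NOT d = 4, NOT infinite volume, NOT a mass gap, NOT Clay).  Width seat `ym3-torus-px5` (gen 12).
THEOREMS ONLY (0 `def`, 0 `sorry`); `--supports stmt-QuantumFields-19200 --as helper`; count-neutral.

WHY.  By LOCATE-hPcol §2–§3 (P1 ✓`Prop7PcolOperatorReduction`), `hPcol` is by duality the sup→sup bound of `D_{U₀} ∘ G_a ∘ R_S` with `R_S = projR = 1 − P` under Lift; the factor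
`‖R_S‖_{ℓ^∞→ℓ^∞} ≤ 1 + ‖P‖_{ℓ^∞→ℓ^∞}` is this file: the pointwise kernel row of V5∕V5b summed over the source.  The same row sum is the `ℓ^∞` form in which the one-form storey's `DPD*`
letter and the (N)-reading of the EX rows consume kernels (lit ✓`B9Eq342GreenPrimeSupBoundDecay.norm_GpOfU_apply_le_rowSum` is the pattern for print's `G′`).
WHAT IS PROVED (ns `Summit.QuantumFields.YangMills.Theorems.Prop7ComplementaryProjectorRowSum`).
* §1 (GENERIC over a displayed kernel letter `hker : ‖((1 − projR)(toL2S(δ_{x′} ⊗ X′)))(x)‖_{W₂} ≤ C_k·e^{−μ′·tdist(B x, B x′)}·‖X′‖_F`, `μ′ > 0`): `equiv_sum_apply` (bookkeeping),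
  `sum_exp_neg_mul_tdist_blocks_le` (`Σ_{x′} e^{−μ′·tdist(B x, B x′)} ≤ (L^d)^{K−n}·(2(1 + 1∕μ′))³` — ✓`sum_comp_iterBlockOf` + px12 ✓`sum_exp_neg_mul_tdist_coarse_le`),
  ★★ `norm_equiv_sub_projR_apply_le_rowSum` — `‖((1 − projR)(toL2S f))(x)‖_{W₂} ≤ C_k·(L^d)^{K−n}·(2(1+1∕μ′))³·sup_{x′}‖f(x′)‖_F` for EVERY site field `f`;
  ★ `norm_equiv_projR_apply_le_rowSum` — `‖(projR(toL2S f))(x)‖_{W₂} ≤ (1 + C_k·(L^d)^{K−n}·(2(1+1∕μ′))³)·sup‖f‖_F` (`R = 1 − P`).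
* §2 ★★★ `norm_equiv_sub_projR_apply_le_rowSum_closed` — §1 with `hker := ` V5b ✓`norm_equiv_sub_projR_single_le_closed`: the `ℓ^∞ → ℓ^∞` bound of `P` from `RegPr` + LOD letters +
  the two windows + coercivity, constant `(c₀∕c₁)·(L^d)^{K−n}·(B₁+B₂)²·C_N(μ′)·(4(2(1+1∕((min μ ¼)∕2 − μ′)))³)²·(2(1+1∕μ′))³` — K-FREE at the pin `c₁ = c₀ℓ³` (`(c₀∕c₁)·(L^d)^{K−n} = 1`).
HYP-SAT (★★OWNER RULING №42): §1's `hker` is inhabited by §2 (V5b, whose letters are inhabited on the literal T³ families per its clause); `μ′ > 0` couples only with `μ′ < (min μ ¼)∕2` —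
satisfiable; nothing eventual; conclusions non-vacuous.
HONEST SCOPE.  Finite sums over a landed kernel row; no new analysis; nothing of `hPcol` (needs the GRADIENT row-sum, LOCATE-hPcol §3 P3), the ten EX rows, `hT`, `hGF`, EX or the crux
is proved here; the Yang–Mills mass gap is NOT proved.

References: T. Bałaban, CMP **99** (1985) 389–434 [Balaban1985BackgroundPropagators] ((3.39) p.397 «|λ| = max sup|λ_μ(x)|», Thm 3.1 (3.42) p.397, (3.49) p.399); CMP **102** (1985) 277–309
[Balaban1985Variational] ((138)–(139) p.299).
-/

set_option autoImplicit false

noncomputable section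

open scoped BigOperators Matrix.Norms.L2Operator InnerProductSpace ComplexConjugate Matrix

namespace Summit.QuantumFields.YangMills.Theorems.Prop7ComplementaryProjectorRowSum

open Literature.MathematicalPhysics.QuantumFieldTheory.Balaban1983to89
open Finset
open T4Continuum BlockAveraging
open BlockAveraging (Idx)
open B7Prop1Explicit (U1 disp)
open B5Eq118OneStroke (iterBlockOf iterBlock mem_iterBlock card_iterBlock)
open B10Eq27TorusAxialLog (holT transl)
open B7TransferAnalyticMean (meanCLM)
open B4Sect5Torus (TSite)
open B9Eq311L2Pairing (WL2)
open B11Eq103H1Complex (SiteL2K BondL2K projR)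
open Summit.QuantumFields.YangMills.Theorems.Prop8Chart (emlIterU)
open Literature.MathematicalPhysics.QuantumFieldTheory.Balaban1983to89.T3ContinuumYM3Torus
open T3SectALandauChart (eta eta_pos bgUnits)
open T3PrintedRegularMinimiser (RegPr)
open T3PrintedRegularOrbits (sites_eq)
open T3LevelShift (siteShift)
open Summit.QuantumFields.YangMills.Theorems.Prop7SectET3Transport (periodsT3 siteEquiv)
open Summit.QuantumFields.YangMills.Theorems.Prop7SectET3HilbertLetters (W₂ frobEquiv toL2 toL2S DL2 DstarL2 covLapSite)
open Summit.QuantumFields.YangMills.Theorems.Prop7BlockBumpExtension (sum_comp_iterBlockOf)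
open Summit.QuantumFields.YangMills.Theorems.Prop7BlockDistanceWeights (sum_exp_neg_mul_tdist_coarse_le tdist_coarse_comm)
open Summit.QuantumFields.YangMills.Theorems.Prop7ComplementaryProjectorPointwiseDecayClosed (norm_equiv_sub_projR_single_le_closed)

variable (F : T3Family) {n K : ℕ} (h : n ≤ K) {c₀ c₁ : ℝ} [Fact (0 < c₀)] [Fact (0 < c₁)]
  {ε₀ : ℝ} (hε₀ : 0 < ε₀) (hε7 : 10 ^ 7 * (F.L : ℝ) ^ 3 * ε₀ ≤ 1)
  (U₀ : GaugeField (F.P K) 0 (Matrix.specialUnitaryGroup (Fin 2) ℂ)) (hreg : RegPr F n K ε₀ U₀)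
  (Q'' : SiteL2K ℂ 3 (periodsT3 F K) c₀ W₂ →ₗ[ℂ] (Site (F.P K) (K - n) → Matrix (Fin 2) (Fin 2) ℂ))
  (hseq : ∀ lam : Site (F.P K) 0 → Matrix (Fin 2) (Fin 2) ℂ, ∃ ns : (j : ℕ) → Site (F.P K) j → Matrix (Fin 2) (Fin 2) ℂ, ns 0 = lam ∧
      (∀ (j : ℕ) (y : Site (F.P K) (j + 1)), ns (j + 1) y = ns j (emb y) - meanCLM (Idx (F.P K)) (Matrix (Fin 2) (Fin 2) ℂ) fun i : Idx (F.P K) =>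
        ns j (emb y) - ((holT (emlIterU j (bgUnits F K U₀)) (emb y) (stairWord i.2.1 (off i.1)) : (Matrix (Fin 2) (Fin 2) ℂ)ˣ) : Matrix (Fin 2) (Fin 2) ℂ) *
          ns j (transl (emb y) (disp (stairWord i.2.1 (off i.1)))) * (((holT (emlIterU j (bgUnits F K U₀)) (emb y) (stairWord i.2.1 (off i.1)))⁻¹ : (Matrix (Fin 2) (Fin 2) ℂ)ˣ) : Matrix (Fin 2) (Fin 2) ℂ)) ∧
      ns (K - n) = Q'' (toL2S F K c₀ lam))
  (ι : (Site (F.P K) (K - n) → Matrix (Fin 2) (Fin 2) ℂ) →ₗ[ℂ] SiteL2K ℂ 3 (periodsT3 F n) c₁ W₂)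
  (hι : ∀ c, ι c = toL2S F n c₁ (fun z => c (siteShift (sites_eq F n K h) z)))
  (T : SiteL2K ℂ 3 (periodsT3 F n) c₁ W₂ →ₗ[ℂ] SiteL2K ℂ 3 (periodsT3 F K) c₀ W₂)
  (hT : ∀ (l : SiteL2K ℂ 3 (periodsT3 F K) c₀ W₂) (f : SiteL2K ℂ 3 (periodsT3 F n) c₁ W₂), ⟪ι (Q'' l), f⟫_ℂ = ⟪l, T f⟫_ℂ)
  {a : ℝ} (ha : 0 < a)
  (G : SiteL2K ℂ 3 (periodsT3 F K) c₀ W₂ →ₗ[ℂ] SiteL2K ℂ 3 (periodsT3 F K) c₀ W₂)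
  (hAG : ∀ f, covLapSite F n K c₀ U₀ (G f) + (a : ℂ) • T (ι (Q'' (G f))) = f)
  (hGA : ∀ u, G (covLapSite F n K c₀ U₀ u + (a : ℂ) • T (ι (Q'' u))) = u)

/-! ## §1 The row sum over a displayed pointwise kernel letter -/

omit [Fact (0 < c₀)] [Fact (0 < c₁)] in
/-- Bookkeeping: the identification `WL2.equiv` commutes with finite sums, pointwise. [folklore] -/
theorem equiv_sum_apply {ιx : Type*} (s : Finset ιx) (g : ιx → SiteL2K ℂ 3 (periodsT3 F K) c₀ W₂) (xt : TSite 3 (periodsT3 F K)) :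
    WL2.equiv ℂ _ W₂ (∑ i ∈ s, g i) xt = ∑ i ∈ s, WL2.equiv ℂ _ W₂ (g i) xt := by
  have e := congrFun (map_sum (WL2.linearEquiv ℂ ℂ (fun _ : TSite 3 (periodsT3 F K) => c₀) (V := W₂)) g s) xt
  simp only [WL2.linearEquiv_apply, Finset.sum_apply] at e
  exact e

omit [Fact (0 < c₀)] [Fact (0 < c₁)] in
/-- **THE FINE ROW SUM OF THE BLOCK-DISTANCE DECAY FACTOR**: `Σ_{x′} e^{−μ′·tdist(B x, B x′)} ≤ (L^d)^{K−n}·(2(1 + 1∕μ′))³` (`μ′ > 0`) — `(L^d)^{K−n}` fine sites per block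
(✓`sum_comp_iterBlockOf`) times the K-∕volume-free coarse sum (px12 ✓`sum_exp_neg_mul_tdist_coarse_le`). [cite: Balaban1985BackgroundPropagators, (3.49) p.399] -/
theorem sum_exp_neg_mul_tdist_blocks_le {μ' : ℝ} (hμ' : 0 < μ') (x : Site (F.P K) 0) :
    ∑ x' : Site (F.P K) 0, Real.exp (-(μ' * (Site.tdist (P := F.P K) (iterBlockOf (K - n) x) (iterBlockOf (K - n) x') : ℝ)))
      ≤ ((((F.P K).L : ℝ) ^ (F.P K).d) ^ (K - n)) * (2 * (1 + 1 / μ')) ^ 3 := by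
  have hk : K - n ≤ (F.P K).m + (F.P K).K := by show K - n ≤ F.m + K; have := F.hm; omega
  rw [sum_comp_iterBlockOf hk (fun z : Site (F.P K) (K - n) => Real.exp (-(μ' * (Site.tdist (P := F.P K) (iterBlockOf (K - n) x) z : ℝ))))]
  refine mul_le_mul_of_nonneg_left ?_ (by have := (F.P K).L_pos; positivity)
  have hc : ∀ z : Site (F.P K) (K - n), Real.exp (-(μ' * (Site.tdist (P := F.P K) (iterBlockOf (K - n) x) z : ℝ)))
      = Real.exp (-(μ' * (Site.tdist (P := F.P K) z (iterBlockOf (K - n) x) : ℝ))) := fun z => by rw [tdist_coarse_comm F]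
  rw [Finset.sum_congr rfl fun z _ => hc z]
  exact sum_exp_neg_mul_tdist_coarse_le F hμ' _

/-- ★★ **THE ROW SUM OF THE POINTWISE KERNEL OF `P = 1 − projR`**: from the kernel letter `hker` (V5∕V5b's shape) and `‖f(x′)‖_F ≤ F_s`,
`‖((1 − projR)(toL2S f))(x)‖_{W₂} ≤ C_k·(L^d)^{K−n}·(2(1+1∕μ′))³·F_s` at every fine site — `f = Σ_{x′} δ_{x′} ⊗ f(x′)`, linearity, the triangle inequality, `sum_exp_neg_mul_tdist_blocks_le`.
[cite: Balaban1985BackgroundPropagators, (3.39) p.397, (3.49) p.399] -/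
theorem norm_equiv_sub_projR_apply_le_rowSum {Ck μ' : ℝ} (hCk : 0 ≤ Ck) (hμ' : 0 < μ')
    (hker : ∀ (x x' : Site (F.P K) 0) (X' : Matrix (Fin 2) (Fin 2) ℂ),
      ‖WL2.equiv ℂ _ W₂ (toL2S F K c₀ (Pi.single x' X') - projR (covLapSite F n K c₀ U₀) Q'' (toL2S F K c₀ (Pi.single x' X'))) (siteEquiv F K x)‖
        ≤ Ck * Real.exp (-(μ' * (Site.tdist (P := F.P K) (iterBlockOf (K - n) x) (iterBlockOf (K - n) x') : ℝ))) * ‖(frobEquiv.symm X' : W₂)‖)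
    (f : Site (F.P K) 0 → Matrix (Fin 2) (Fin 2) ℂ) {Fs : ℝ} (hFs : ∀ x', ‖(frobEquiv.symm (f x') : W₂)‖ ≤ Fs) (x : Site (F.P K) 0) :
    ‖WL2.equiv ℂ _ W₂ (toL2S F K c₀ f - projR (covLapSite F n K c₀ U₀) Q'' (toL2S F K c₀ f)) (siteEquiv F K x)‖
      ≤ Ck * ((((F.P K).L : ℝ) ^ (F.P K).d) ^ (K - n)) * (2 * (1 + 1 / μ')) ^ 3 * Fs := by
  classical
  have hFs0 : 0 ≤ Fs := (norm_nonneg _).trans (hFs x)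
  -- `f = Σ_{x′} δ_{x′} ⊗ f(x′)` pushed through the linear maps
  have hf : f = ∑ x' : Site (F.P K) 0, Pi.single x' (f x') := (Finset.univ_sum_single f).symm
  have hsplit : toL2S F K c₀ f - projR (covLapSite F n K c₀ U₀) Q'' (toL2S F K c₀ f)
      = ∑ x' : Site (F.P K) 0, (toL2S F K c₀ (Pi.single x' (f x')) - projR (covLapSite F n K c₀ U₀) Q'' (toL2S F K c₀ (Pi.single x' (f x')))) := by
    conv_lhs => rw [hf]
    rw [map_sum, map_sum, Finset.sum_sub_distrib]
  rw [hsplit, equiv_sum_apply]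
  refine (norm_sum_le _ _).trans ?_
  calc ∑ x' : Site (F.P K) 0, ‖WL2.equiv ℂ _ W₂ (toL2S F K c₀ (Pi.single x' (f x')) - projR (covLapSite F n K c₀ U₀) Q'' (toL2S F K c₀ (Pi.single x' (f x')))) (siteEquiv F K x)‖
      ≤ ∑ x' : Site (F.P K) 0, Ck * Real.exp (-(μ' * (Site.tdist (P := F.P K) (iterBlockOf (K - n) x) (iterBlockOf (K - n) x') : ℝ))) * Fs := by
        refine Finset.sum_le_sum fun x' _ => (hker x x' (f x')).trans ?_
        exact mul_le_mul_of_nonneg_left (hFs x') (mul_nonneg hCk (Real.exp_pos _).le)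
    _ = Ck * Fs * ∑ x' : Site (F.P K) 0, Real.exp (-(μ' * (Site.tdist (P := F.P K) (iterBlockOf (K - n) x) (iterBlockOf (K - n) x') : ℝ))) := by
        rw [Finset.mul_sum]; refine Finset.sum_congr rfl fun x' _ => ?_; ring
    _ ≤ Ck * Fs * (((((F.P K).L : ℝ) ^ (F.P K).d) ^ (K - n)) * (2 * (1 + 1 / μ')) ^ 3) :=
        mul_le_mul_of_nonneg_left (sum_exp_neg_mul_tdist_blocks_le F (n := n) (K := K) hμ' x) (mul_nonneg hCk hFs0)
    _ = Ck * ((((F.P K).L : ℝ) ^ (F.P K).d) ^ (K - n)) * (2 * (1 + 1 / μ')) ^ 3 * Fs := by ring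

/-- ★ **`R = projR` IS BOUNDED `ℓ^∞ → ℓ^∞`**: `‖(projR(toL2S f))(x)‖_{W₂} ≤ (1 + C_k·(L^d)^{K−n}·(2(1+1∕μ′))³)·F_s` — `R = 1 − P`, `‖(toL2S f)(x)‖_{W₂} = ‖f(x)‖_F` (✓`toL2S_apply`).
[cite: Balaban1985BackgroundPropagators, (3.21) p.394, (3.39) p.397] -/
theorem norm_equiv_projR_apply_le_rowSum {Ck μ' : ℝ} (hCk : 0 ≤ Ck) (hμ' : 0 < μ')
    (hker : ∀ (x x' : Site (F.P K) 0) (X' : Matrix (Fin 2) (Fin 2) ℂ),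
      ‖WL2.equiv ℂ _ W₂ (toL2S F K c₀ (Pi.single x' X') - projR (covLapSite F n K c₀ U₀) Q'' (toL2S F K c₀ (Pi.single x' X'))) (siteEquiv F K x)‖
        ≤ Ck * Real.exp (-(μ' * (Site.tdist (P := F.P K) (iterBlockOf (K - n) x) (iterBlockOf (K - n) x') : ℝ))) * ‖(frobEquiv.symm X' : W₂)‖)
    (f : Site (F.P K) 0 → Matrix (Fin 2) (Fin 2) ℂ) {Fs : ℝ} (hFs : ∀ x', ‖(frobEquiv.symm (f x') : W₂)‖ ≤ Fs) (x : Site (F.P K) 0) :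
    ‖WL2.equiv ℂ _ W₂ (projR (covLapSite F n K c₀ U₀) Q'' (toL2S F K c₀ f)) (siteEquiv F K x)‖
      ≤ (1 + Ck * ((((F.P K).L : ℝ) ^ (F.P K).d) ^ (K - n)) * (2 * (1 + 1 / μ')) ^ 3) * Fs := by
  have hP := norm_equiv_sub_projR_apply_le_rowSum F U₀ Q'' hCk hμ' hker f hFs x
  have hfx : ‖WL2.equiv ℂ _ W₂ (toL2S F K c₀ f) (siteEquiv F K x)‖ ≤ Fs := by
    rw [Prop7SectET3HilbertLetters.toL2S_apply, Equiv.symm_apply_apply]; exact hFs x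
  have e : projR (covLapSite F n K c₀ U₀) Q'' (toL2S F K c₀ f)
      = toL2S F K c₀ f - (toL2S F K c₀ f - projR (covLapSite F n K c₀ U₀) Q'' (toL2S F K c₀ f)) := by abel
  rw [e, WL2.equiv_sub, Pi.sub_apply]
  calc ‖WL2.equiv ℂ _ W₂ (toL2S F K c₀ f) (siteEquiv F K x)
          - WL2.equiv ℂ _ W₂ (toL2S F K c₀ f - projR (covLapSite F n K c₀ U₀) Q'' (toL2S F K c₀ f)) (siteEquiv F K x)‖
      ≤ ‖WL2.equiv ℂ _ W₂ (toL2S F K c₀ f) (siteEquiv F K x)‖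
          + ‖WL2.equiv ℂ _ W₂ (toL2S F K c₀ f - projR (covLapSite F n K c₀ U₀) Q'' (toL2S F K c₀ f)) (siteEquiv F K x)‖ := norm_sub_le _ _
    _ ≤ Fs + Ck * ((((F.P K).L : ℝ) ^ (F.P K).d) ^ (K - n)) * (2 * (1 + 1 / μ')) ^ 3 * Fs := add_le_add hfx hP
    _ = (1 + Ck * ((((F.P K).L : ℝ) ^ (F.P K).d) ^ (K - n)) * (2 * (1 + 1 / μ')) ^ 3) * Fs := by ring

/-! ## §2 Closed: the kernel letter from V5b -/

include hε₀ hε7 hreg hseq hι hT ha hAG hGA in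
set_option maxHeartbeats 400000 in
-- hb: the statement carries V5b's closed-form constant (B2c's Gram constant and V4's `B₁ + B₂`; README №24 class).
/-- ★★★ **`P = 1 − R_{Q″}(U₀)` IS BOUNDED `ℓ^∞ → ℓ^∞` ON THE FINE SITES, FROM THE MEMBER LETTERS** — §1 with `hker :=` V5b ✓`norm_equiv_sub_projR_single_le_closed`: for every site field `f` with
`‖f(x′)‖_F ≤ F_s`, `‖((1 − projR Δ_{U₀} Q″)(toL2S f))(x)‖_{W₂} ≤ (c₀∕c₁)·(B₁+B₂)²·C_N(μ′)·(4(2(1+1∕((min μ ¼)∕2 − μ′)))³)²·(L^d)^{K−n}·(2(1+1∕μ′))³·F_s`; at the pin `c₁ = c₀ℓ³` the product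
`(c₀∕c₁)·(L^d)^{K−n}` is `1` — K-FREE. [cite: Balaban1985BackgroundPropagators, Thm 3.1 (3.42) p.397, (3.49) p.399; Balaban1985Variational, (138)–(139) p.299] -/
theorem norm_equiv_sub_projR_apply_le_rowSum_closed
    {μ : ℝ} (hμ : 0 < μ) {δ₂ : ℝ} (hδ₂ : 0 ≤ δ₂)
    (hδ₂w : 3 * ((eta F n K)⁻¹) ^ 2 * (Real.exp (μ * eta F n K) - 1) ^ 2 + a * ((25 / 8) * (c₁ * ((((F.P K).L : ℝ) ^ (F.P K).d) ^ (K - n))⁻¹ / c₀)) * (Real.exp (3 * μ) - 1) ^ 2 ≤ δ₂ ^ 2)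
    (hwin₂ : Real.sqrt (max 2 (16 * c₀ * ((F.L : ℝ) ^ (K - n)) ^ 3 / (a * c₁))) * δ₂ ≤ 1 / 10)
    {μ' : ℝ} (hμ' : 0 < μ') (hμ'κ : μ' < (min μ (1 / 4) / 2))
    {δ₁ : ℝ} (hδ₁ : 0 ≤ δ₁)
    (hδ : 3 * ((eta F n K)⁻¹) ^ 2 * (Real.exp (μ' * eta F n K) - 1) ^ 2 + a * ((25 / 8) * (c₁ * ((((F.P K).L : ℝ) ^ (F.P K).d) ^ (K - n))⁻¹ / c₀)) * (Real.exp (3 * μ') - 1) ^ 2 ≤ δ₁ ^ 2)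
    (hwin : Real.sqrt (max 2 (16 * c₀ * ((F.L : ℝ) ^ (K - n)) ^ 3 / (a * c₁))) * δ₁ ≤ 1 / 10)
    {CT : ℝ} (hCT : 0 ≤ CT) (hCTb : ∀ l : SiteL2K ℂ 3 (periodsT3 F K) c₀ W₂, ‖ι (Q'' l)‖ ≤ CT * ‖l‖)
    {CG : ℝ} (hCG : 0 ≤ CG) (hGn : ∀ f, ‖G f‖ ≤ CG * ‖f‖)
    {mB : ℝ} (hmB : 0 < mB) (hcoer : ∀ f : SiteL2K ℂ 3 (periodsT3 F n) c₁ W₂, mB * ‖f‖ ≤ ‖G (T f)‖)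
    (hgap : 3 * ((Real.sqrt (max 2 (16 * c₀ * ((F.L : ℝ) ^ (K - n)) ^ 3 / (a * c₁))) * (2 + Real.sqrt (max 2 (16 * c₀ * ((F.L : ℝ) ^ (K - n)) ^ 3 / (a * c₁)))))
          * (Real.sqrt 3 * (eta F n K)⁻¹ * (Real.exp (μ' * eta F n K) - 1) + (Real.sqrt 3 * (eta F n K)⁻¹ * (Real.exp (μ' * eta F n K) - 1)) ^ 2 + Real.sqrt a * CT * (Real.exp (3 * μ') - 1) + a * CT ^ 2 * (Real.exp (3 * μ') - 1) ^ 2)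
          * (8 * Real.sqrt (max 2 (16 * c₀ * ((F.L : ℝ) ^ (K - n)) ^ 3 / (a * c₁))) + 8 * Real.sqrt (max 2 (16 * c₀ * ((F.L : ℝ) ^ (K - n)) ^ 3 / (a * c₁))) ^ 2)
          * (CT * (1 + (Real.exp (3 * μ') - 1))) + CG * (CT * (Real.exp (3 * μ') - 1))) ^ 2 < mB ^ 2 / 2)
    (f : Site (F.P K) 0 → Matrix (Fin 2) (Fin 2) ℂ) {Fs : ℝ} (hFs : ∀ x', ‖(frobEquiv.symm (f x') : W₂)‖ ≤ Fs) (x : Site (F.P K) 0) :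
    ‖WL2.equiv ℂ _ W₂ (toL2S F K c₀ f - projR (covLapSite F n K c₀ U₀) Q'' (toL2S F K c₀ f)) (siteEquiv F K x)‖
      ≤ ((c₀ / c₁) * ((14 * (8 * Real.exp (3 * min μ (1 / 4)) *
              ((5 / 4) * Real.sqrt (2 * c₁) * ((((F.P K).L : ℝ) ^ (F.P K).d) ^ (K - n))⁻¹ / c₀ * Real.sqrt (2 * c₁)
                + Real.exp (3 * μ) * ((a * ((5 / 4) * Real.sqrt (2 * c₁) * ((((F.P K).L : ℝ) ^ (F.P K).d) ^ (K - n))⁻¹ / c₀) *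
                    Real.sqrt ((25 / 8) * (c₁ * ((((F.P K).L : ℝ) ^ (F.P K).d) ^ (K - n))⁻¹ / c₀))) *
                  ((8 * Real.sqrt (max 2 (16 * c₀ * ((F.L : ℝ) ^ (K - n)) ^ 3 / (a * c₁))) ^ 2) *
                    (Real.sqrt ((25 / 8) * (c₁ * ((((F.P K).L : ℝ) ^ (F.P K).d) ^ (K - n))⁻¹ / c₀)) * Real.sqrt (2 * c₁)))))))
          + (Real.sqrt (3 ^ 3 / (c₀ * ((F.L : ℝ) ^ (K - n)) ^ 3) * 8) *
              (Real.sqrt (8 * Real.exp (3 * min μ (1 / 4)) * Real.exp (6 * μ) * (2 * (1 + 1 / μ)) ^ 3) *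
              ((8 * Real.sqrt (max 2 (16 * c₀ * ((F.L : ℝ) ^ (K - n)) ^ 3 / (a * c₁))) ^ 2) *
                (Real.sqrt ((25 / 8) * (c₁ * ((((F.P K).L : ℝ) ^ (F.P K).d) ^ (K - n))⁻¹ / c₀)) * Real.sqrt (2 * c₁)))))) ^ 2 * ((mB ^ 2 / 2 - 3 * ((Real.sqrt (max 2 (16 * c₀ * ((F.L : ℝ) ^ (K - n)) ^ 3 / (a * c₁))) * (2 + Real.sqrt (max 2 (16 * c₀ * ((F.L : ℝ) ^ (K - n)) ^ 3 / (a * c₁)))))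
          * (Real.sqrt 3 * (eta F n K)⁻¹ * (Real.exp (μ' * eta F n K) - 1) + (Real.sqrt 3 * (eta F n K)⁻¹ * (Real.exp (μ' * eta F n K) - 1)) ^ 2 + Real.sqrt a * CT * (Real.exp (3 * μ') - 1) + a * CT ^ 2 * (Real.exp (3 * μ') - 1) ^ 2)
          * (8 * Real.sqrt (max 2 (16 * c₀ * ((F.L : ℝ) ^ (K - n)) ^ 3 / (a * c₁))) + 8 * Real.sqrt (max 2 (16 * c₀ * ((F.L : ℝ) ^ (K - n)) ^ 3 / (a * c₁))) ^ 2)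
          * (CT * (1 + (Real.exp (3 * μ') - 1))) + CG * (CT * (Real.exp (3 * μ') - 1))) ^ 2)⁻¹ * Real.exp (9 * μ'))
        * (4 * (2 * (1 + 1 / ((min μ (1 / 4) / 2) - μ'))) ^ 3) ^ 2) * ((((F.P K).L : ℝ) ^ (F.P K).d) ^ (K - n)) * (2 * (1 + 1 / μ')) ^ 3 * Fs := by
  have hc₀ : 0 < c₀ := Fact.out
  have hc₁ : 0 < c₁ := Fact.out
  have hLP := (F.P K).L_pos
  have hCN : 0 ≤ ((mB ^ 2 / 2 - 3 * ((Real.sqrt (max 2 (16 * c₀ * ((F.L : ℝ) ^ (K - n)) ^ 3 / (a * c₁))) * (2 + Real.sqrt (max 2 (16 * c₀ * ((F.L : ℝ) ^ (K - n)) ^ 3 / (a * c₁)))))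
          * (Real.sqrt 3 * (eta F n K)⁻¹ * (Real.exp (μ' * eta F n K) - 1) + (Real.sqrt 3 * (eta F n K)⁻¹ * (Real.exp (μ' * eta F n K) - 1)) ^ 2 + Real.sqrt a * CT * (Real.exp (3 * μ') - 1) + a * CT ^ 2 * (Real.exp (3 * μ') - 1) ^ 2)
          * (8 * Real.sqrt (max 2 (16 * c₀ * ((F.L : ℝ) ^ (K - n)) ^ 3 / (a * c₁))) + 8 * Real.sqrt (max 2 (16 * c₀ * ((F.L : ℝ) ^ (K - n)) ^ 3 / (a * c₁))) ^ 2)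
          * (CT * (1 + (Real.exp (3 * μ') - 1))) + CG * (CT * (Real.exp (3 * μ') - 1))) ^ 2)⁻¹ * Real.exp (9 * μ')) :=
    mul_nonneg (le_of_lt (inv_pos.2 (sub_pos.2 hgap))) (Real.exp_pos _).le
  have hCk : 0 ≤ (c₀ / c₁) * ((14 * (8 * Real.exp (3 * min μ (1 / 4)) *
              ((5 / 4) * Real.sqrt (2 * c₁) * ((((F.P K).L : ℝ) ^ (F.P K).d) ^ (K - n))⁻¹ / c₀ * Real.sqrt (2 * c₁)
                + Real.exp (3 * μ) * ((a * ((5 / 4) * Real.sqrt (2 * c₁) * ((((F.P K).L : ℝ) ^ (F.P K).d) ^ (K - n))⁻¹ / c₀) *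
                    Real.sqrt ((25 / 8) * (c₁ * ((((F.P K).L : ℝ) ^ (F.P K).d) ^ (K - n))⁻¹ / c₀))) *
                  ((8 * Real.sqrt (max 2 (16 * c₀ * ((F.L : ℝ) ^ (K - n)) ^ 3 / (a * c₁))) ^ 2) *
                    (Real.sqrt ((25 / 8) * (c₁ * ((((F.P K).L : ℝ) ^ (F.P K).d) ^ (K - n))⁻¹ / c₀)) * Real.sqrt (2 * c₁)))))))
          + (Real.sqrt (3 ^ 3 / (c₀ * ((F.L : ℝ) ^ (K - n)) ^ 3) * 8) *
              (Real.sqrt (8 * Real.exp (3 * min μ (1 / 4)) * Real.exp (6 * μ) * (2 * (1 + 1 / μ)) ^ 3) *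
              ((8 * Real.sqrt (max 2 (16 * c₀ * ((F.L : ℝ) ^ (K - n)) ^ 3 / (a * c₁))) ^ 2) *
                (Real.sqrt ((25 / 8) * (c₁ * ((((F.P K).L : ℝ) ^ (F.P K).d) ^ (K - n))⁻¹ / c₀)) * Real.sqrt (2 * c₁)))))) ^ 2 * ((mB ^ 2 / 2 - 3 * ((Real.sqrt (max 2 (16 * c₀ * ((F.L : ℝ) ^ (K - n)) ^ 3 / (a * c₁))) * (2 + Real.sqrt (max 2 (16 * c₀ * ((F.L : ℝ) ^ (K - n)) ^ 3 / (a * c₁)))))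
          * (Real.sqrt 3 * (eta F n K)⁻¹ * (Real.exp (μ' * eta F n K) - 1) + (Real.sqrt 3 * (eta F n K)⁻¹ * (Real.exp (μ' * eta F n K) - 1)) ^ 2 + Real.sqrt a * CT * (Real.exp (3 * μ') - 1) + a * CT ^ 2 * (Real.exp (3 * μ') - 1) ^ 2)
          * (8 * Real.sqrt (max 2 (16 * c₀ * ((F.L : ℝ) ^ (K - n)) ^ 3 / (a * c₁))) + 8 * Real.sqrt (max 2 (16 * c₀ * ((F.L : ℝ) ^ (K - n)) ^ 3 / (a * c₁))) ^ 2)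
          * (CT * (1 + (Real.exp (3 * μ') - 1))) + CG * (CT * (Real.exp (3 * μ') - 1))) ^ 2)⁻¹ * Real.exp (9 * μ')) * (4 * (2 * (1 + 1 / ((min μ (1 / 4) / 2) - μ'))) ^ 3) ^ 2 :=
    mul_nonneg (mul_nonneg (by positivity) hCN) (by positivity)
  refine norm_equiv_sub_projR_apply_le_rowSum F U₀ Q'' hCk hμ' (fun x x' X' => ?_) f hFs x
  have hk := norm_equiv_sub_projR_single_le_closed F h hε₀ hε7 U₀ hreg Q'' hseq ι hι T hT ha G hAG hGA hμ hδ₂ hδ₂w hwin₂ hμ'.le hμ'κ hδ₁ hδ hwin hCT hCTb hCG hGn hmB hcoer hgap x x' X'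
  calc _ ≤ _ := hk
    _ = _ := by ring

end Summit.QuantumFields.YangMills.Theorems.Prop7ComplementaryProjectorRowSum

end
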